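import Summits.QuantumFields.BalabanUV.Beta.GAN24.ExitFaceCurrentDivBlockSum
import Summits.QuantumFields.BalabanUV.Beta.GAN24.LegWeightedDressedRow
import Summits.QuantumFields.BalabanUV.Beta.GAN24.FaceDatumMultiplierResponse
import Summits.QuantumFields.BalabanUV.Beta.GAN24.SlotWeightedVertex

/-!
# `BalabanUV.Beta.GAN24.ExitFaceCurrentDescent` — binder row G-an2-4 ∕ (CONV-C), W-slot CT-W, conservation law (C)∕(C)sym AT LEVELS `j + 1 ≥ 1`, the DESCENT STEP of this lineage's
# note `HOME/b2b-balaban-gan24-formalise-leaf-04/g68/EXIT-FACE-CURRENT-TOWER.md` §4 (C)(D): **WHEN THE MULTIPLIER RESPONSE OF `G_j` TO THE LEG DATUM `ρ` VANISHES, THE DIVERGENCE OF THE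
# LEVEL-`(j+1)` SLOT∕LEG-WEIGHTED CURRENT AT `y` IS `−cH_j ×` THE BLOCK SUM OVER `block(y)` OF THE SECOND-LEG LATTICE DIVERGENCE OF THE LEVEL-`j` CURRENT**
# `t^{(j)}(κ′, v) := Σ_κ″ Σ'_q H_ρ(κ″,q)·Σ_κ‴ Σ'_u σ′(κ‴,u)·S κ‴ u q v (inl κ″)(inl κ′)`, `H_ρ(κ″,q) := Σ'_w ρ(w)·colH G_j Lc β w κ″ q` (the FIELD response of `G_j` to `ρ ê_β`),
# `σ′(κ‴,u) := Σ'_t σ(t)·colH G_j Lc ν t κ‴ u` (the field response to the slot datum) — a current of the SAME shape one level down; and the face datum `ρ = 𝟙{w_β ≡ −1 (Lc)}` HAS zero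
# multiplier response (`FaceDatumMultiplierResponse`).

NOT IN PRINT; OUR BOOKKEEPING ([folklore] `tsum` bookkeeping BY NAME over this gen's T2b assembly `ExitFaceCurrentDivBlockSum.div_faceSlot_current_eq_blockSum`, T2b-(i)
`LegWeightedDressedRow.tsum_legWeight_mulRow_comp`, T2b-(ii) `SlotWeightedVertex.tsum_slotWeight_vertexOfK`, `FaceDatumMultiplierResponse.tsum_face_mul_dressed_mm_eq_zero`, leaf-06's
`ResolventLegCharges.tsum_exp_coarse_le'`; G-an2-4 formalisation swarm, leaf prover `b2b-balaban-gan24-formalise-leaf-04`, gen 68).  HONEST FRAMING (cell contract, verbatim): «discharging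
`BetaPertH` makes Bałaban's UV stability UNCONDITIONAL — a real constructive-QFT result; it is NOT the continuum limit and NOT the Clay problem.»  HONEST DEPENDENCY (verbatim): «continuum YM
on T⁴ ⇐ BetaPertH ∧ nine spine estimates (0/9 proved); BetaPertH ⇐ (D1) ∧ (D4) ∧ CAP+tail; G-an2-4 gates asym, D1 and NE2/3/4.»

WHAT ([folklore]; generic `d`, `[NeZero Lc]`, in-block root `r ∈ box Lc`, every `j`, ANY local parity-odd table family `S`, weights `|σ|, |ρ| ≤ 1`; 0 `def`, 0 cited facts, 0 `def … : Prop`,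
0 sorry): §1 `abs_legResponse_le` (`|H_ρ(κ″,q)| ≤ C·e^{δLc(d+1)}·Zl δ` uniformly in `q`), `summable_midleg_slot_biLocFamily` ∕ `tsum_midleg_slot_comm` (the `(q,t)` Fubini for a family
bi-localised at `(Lc•t, Lc•t)` against a bounded mid-leg weight); §2 `tsum_leg_comp_eq_neg_fieldResponse` (generic decaying `K` with `trK K = sgnK K`, `V` bi-localised: IF
`Σ'_w ρ w·K q (N•w)(inr m)(inr β) = 0` for all `m q` THEN `Σ'_w ρ w·(K ∘ V)(N•w, v)(inr β, f) = −Σ_κ″ Σ'_q H_ρ(κ″,q)·V q v (inl κ″) f`), `tsum_face_mul_dressed_mm_raw_eq_zero` (the face datum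
satisfies the IF for `K = G_j`); §3 **`div_faceSlot_current_eq_neg_blockSum_descent`**: under that IF,
`Σ_μ (J(μ,y) − J(μ,y−e_μ)) = −cH_j·Σ_{r′∈box Lc} Σ_κ′ (t^{(j)}(κ′, Lc•y + r′) − t^{(j)}(κ′, Lc•y + r′ − e_κ′))`, and **`div_faceSlot_current_eq_zero_of_descent`**: if the level-`j` current
`t^{(j)}` is second-leg divergence-free at every site of `block(y)` then `Σ_μ (J(μ,y) − J(μ,y−e_μ)) = 0`.  Asserts NO value of Bałaban's tables; discharges NOTHING of (C)sym ∕ (Q-D) ∕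
(Q-D-rate) ∕ «T2Shape» ∕ «T2Drift» ∕ (hW, hWall); NEVER «G-an2-4 closed» as (CONV-C); NOT D1, NOT `BetaPertH`, NOT continuum, NOT Clay.
2026-08-23; no existing file touched.
-/

noncomputable section

open Finset
open scoped BigOperators
open Literature.MathematicalPhysics.QuantumFieldTheory
open Literature.MathematicalPhysics.QuantumFieldTheory.Balaban1983to89
open Literature.MathematicalPhysics.QuantumFieldTheory.Balaban1983to89.Beta
open B12Sec2to5 (l1 l1_nonneg)
open ExpKernelCalculus (Site MKer comp Decays BiLoc Zl Zl_nonneg summable_exp_shift' tsum_exp_shift' l1_sub_symm)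
open AffineAveraging (box toSite)
open B6BondElimination (unitVec)
open OneStepResolventKernel (Fib LocStencil biLoc_mono decays_mono)
open OneStepKernelFamily (KInvStep vertexOfK colH abs_colH_le vertexFamily_vertexOfK)
open Summit.QuantumFields.BalabanUV.Beta.TameKernelCalculus (trK)
open Summit.QuantumFields.BalabanUV.Beta.BorderedHessian (stepScale sgnK)
open Summit.QuantumFields.BalabanUV.Beta.AxialDressingRooted (coDressKBmAt decays_coDressKBmAt_KInvStep)
open Summit.QuantumFields.BalabanUV.Beta.BubbleParity (trK_coDressKBmAt_KInvStep)
open Summit.QuantumFields.BalabanUV.Beta.HessKerDressedUnits (unitK unitK_one)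
open Summit.QuantumFields.BalabanUV.Beta.SpineRooted (e3OfK)
open Summit.QuantumFields.BalabanUV.Beta.GAN24.ResolventLegCharges (summable_exp_coarse' tsum_exp_coarse_le')
open Summit.QuantumFields.BalabanUV.Beta.GAN24.ExitFaceCurrentDivBlockSum (summable_slot_biLocFamily div_faceSlot_current_eq_blockSum)
open Summit.QuantumFields.BalabanUV.Beta.GAN24.LegWeightedDressedRow (tsum_legWeight_mulRow_comp)
open Summit.QuantumFields.BalabanUV.Beta.GAN24.FaceDatumMultiplierResponse (tsum_face_mul_dressed_mm_eq_zero)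
open Summit.QuantumFields.BalabanUV.Beta.GAN24.SlotWeightedVertex (tsum_slotWeight_vertexOfK)

namespace Summit.QuantumFields.BalabanUV.Beta.GAN24.ExitFaceCurrentDescent

variable {d : ℕ} {Lc : ℕ} [NeZero Lc] {r : Fin (d + 1) → ℕ} {S : Fin (d + 1) → (Fin (d + 1) → ℤ) → MKer (d + 1) (Fib d)} {Cs δs : ℝ}

/-! ## §1 Bounded leg response; the `(q,t)` Fubini -/

omit [NeZero Lc] in
/-- [folklore] **THE FIELD RESPONSE TO A BOUNDED LEG DATUM IS BOUNDED UNIFORMLY**: `|Σ'_w ρ w·colH K N β w κ″ q| ≤ B·C·e^{δN(d+1)}·Zl δ`. -/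
theorem abs_legResponse_le {N : ℕ} [NeZero N] {K : MKer (d + 1) (Fib d)} {C δ : ℝ} (hK : Decays K C δ) (hδ : 0 < δ)
    {ρ : Site (d + 1) → ℝ} {B : ℝ} (hρ : ∀ w, |ρ w| ≤ B) (β κ'' : Fin (d + 1)) (q : Site (d + 1)) :
    |∑' w : Site (d + 1), ρ w * colH K N β w κ'' q| ≤ B * C * (Real.exp (δ * ((N : ℝ) * (d + 1))) * Zl (d + 1) δ) := by
  have hN : 1 ≤ N := Nat.one_le_iff_ne_zero.mpr (NeZero.ne N)
  have hC : 0 ≤ C := hK.nonneg (Sum.inl 0)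
  have hB : 0 ≤ B := (abs_nonneg _).trans (hρ 0)
  have hmaj : ∀ w : Site (d + 1), ‖ρ w * colH K N β w κ'' q‖ ≤ B * C * Real.exp (-δ * l1 (q - (N : ℤ) • w)) := by
    intro w
    rw [Real.norm_eq_abs, abs_mul, mul_assoc]
    exact mul_le_mul (hρ w) (abs_colH_le hK β w κ'' q) (abs_nonneg _) hB
  have hs : Summable fun w : Site (d + 1) => B * C * Real.exp (-δ * l1 (q - (N : ℤ) • w)) := (summable_exp_coarse' (d := d) hN hδ q).mul_left _
  calc |∑' w : Site (d + 1), ρ w * colH K N β w κ'' q| = ‖∑' w : Site (d + 1), ρ w * colH K N β w κ'' q‖ := (Real.norm_eq_abs _).symm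
    _ ≤ ∑' w : Site (d + 1), B * C * Real.exp (-δ * l1 (q - (N : ℤ) • w)) := tsum_of_norm_bounded hs.hasSum hmaj
    _ = B * C * ∑' w : Site (d + 1), Real.exp (-δ * l1 (q - (N : ℤ) • w)) := tsum_mul_left
    _ ≤ B * C * (Real.exp (δ * ((N : ℝ) * (d + 1))) * Zl (d + 1) δ) := mul_le_mul_of_nonneg_left (tsum_exp_coarse_le' (d := d) N hδ q) (mul_nonneg hB hC)

/-- [folklore] For a family `V_t` bi-localised at `(Lc•t, Lc•t)` uniformly in `t`, a bounded mid-leg weight `H` and a slot weight `|σ| ≤ 1`, the `(q,t)` family `H q·σ t·V_t q v a b` is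
absolutely summable. -/
theorem summable_midleg_slot_biLocFamily {V : Site (d + 1) → MKer (d + 1) (Fib d)} {C δ : ℝ} (hV : ∀ t, BiLoc (V t) ((Lc : ℤ) • t) ((Lc : ℤ) • t) C δ) (hδ : 0 < δ)
    {σ H : Site (d + 1) → ℝ} (hσ : ∀ t, |σ t| ≤ 1) {B : ℝ} (hH : ∀ q, |H q| ≤ B) (v : Site (d + 1)) (a b : Fib d) :
    Summable fun qt : Site (d + 1) × Site (d + 1) => |H qt.1 * (σ qt.2 * V qt.2 qt.1 v a b)| := by
  have hLc : 1 ≤ Lc := Nat.one_le_iff_ne_zero.mpr (NeZero.ne Lc)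
  have hB : 0 ≤ B := (abs_nonneg _).trans (hH 0)
  have hC : 0 ≤ C := (hV 0).nonneg (Sum.inl 0)
  -- majorant `B·C·e^{−δ|q − Lc t|}·e^{−δ|v − Lc t|}`
  have hMs : Summable fun qt : Site (d + 1) × Site (d + 1) => B * C * (Real.exp (-δ * l1 (qt.1 - (Lc : ℤ) • qt.2)) * Real.exp (-δ * l1 (v - (Lc : ℤ) • qt.2))) := by
    refine Summable.mul_left (B * C) ?_
    have hs : Summable fun tq : Site (d + 1) × Site (d + 1) => Real.exp (-δ * l1 (tq.2 - (Lc : ℤ) • tq.1)) * Real.exp (-δ * l1 (v - (Lc : ℤ) • tq.1)) := by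
      refine (summable_prod_of_nonneg (fun tq => mul_nonneg (Real.exp_pos _).le (Real.exp_pos _).le)).2 ⟨fun t => ?_, ?_⟩
      · exact ((summable_exp_shift' hδ ((Lc : ℤ) • t))).mul_right (Real.exp (-δ * l1 (v - (Lc : ℤ) • t)))
      · have hb : ∀ t : Site (d + 1), ∑' q : Site (d + 1), Real.exp (-δ * l1 (q - (Lc : ℤ) • t)) * Real.exp (-δ * l1 (v - (Lc : ℤ) • t)) =
            Zl (d + 1) δ * Real.exp (-δ * l1 (v - (Lc : ℤ) • t)) := by
          intro t
          rw [tsum_mul_right, tsum_exp_shift' ((Lc : ℤ) • t)]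
        simp only [hb]
        exact (summable_exp_coarse' (d := d) hLc hδ v).mul_left (Zl (d + 1) δ)
    exact ((Equiv.prodComm (Site (d + 1)) (Site (d + 1))).summable_iff.2 hs).congr fun qt => by simp
  refine Summable.of_nonneg_of_le (fun _ => abs_nonneg _) (fun qt => ?_) hMs
  rw [abs_mul, abs_mul]
  have h := hV qt.2 qt.1 v a b
  calc |H qt.1| * (|σ qt.2| * |V qt.2 qt.1 v a b|) ≤ B * (1 * (C * Real.exp (-δ * (l1 (qt.1 - (Lc : ℤ) • qt.2) + l1 (v - (Lc : ℤ) • qt.2))))) :=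
        mul_le_mul (hH qt.1) (mul_le_mul (hσ qt.2) h (abs_nonneg _) zero_le_one) (by positivity) hB
    _ = B * C * (Real.exp (-δ * l1 (qt.1 - (Lc : ℤ) • qt.2)) * Real.exp (-δ * l1 (v - (Lc : ℤ) • qt.2))) := by
        rw [one_mul, mul_add, Real.exp_add]; ring

/-- [folklore] **THE `(q,t)` FUBINI**: `Σ'_t σ t·Σ'_q H q·V_t q v a b = Σ'_q H q·Σ'_t σ t·V_t q v a b`, and the `t`-family `σ t·Σ'_q H q·V_t q v a b` is summable. -/
theorem tsum_midleg_slot_comm {V : Site (d + 1) → MKer (d + 1) (Fib d)} {C δ : ℝ} (hV : ∀ t, BiLoc (V t) ((Lc : ℤ) • t) ((Lc : ℤ) • t) C δ) (hδ : 0 < δ)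
    {σ H : Site (d + 1) → ℝ} (hσ : ∀ t, |σ t| ≤ 1) {B : ℝ} (hH : ∀ q, |H q| ≤ B) (v : Site (d + 1)) (a b : Fib d) :
    (Summable fun t : Site (d + 1) => σ t * ∑' q : Site (d + 1), H q * V t q v a b) ∧
    ∑' t : Site (d + 1), σ t * ∑' q : Site (d + 1), H q * V t q v a b = ∑' q : Site (d + 1), H q * ∑' t : Site (d + 1), σ t * V t q v a b := by
  have hs : Summable fun qt : Site (d + 1) × Site (d + 1) => H qt.1 * (σ qt.2 * V qt.2 qt.1 v a b) :=
    Summable.of_norm_bounded (summable_midleg_slot_biLocFamily hV hδ hσ hH v a b) (fun qt => by rw [Real.norm_eq_abs])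
  have hs' : Summable fun tq : Site (d + 1) × Site (d + 1) => H tq.2 * (σ tq.1 * V tq.1 tq.2 v a b) :=
    ((Equiv.prodComm (Site (d + 1)) (Site (d + 1))).summable_iff.2 hs).congr fun tq => by simp
  have e : ∀ t : Site (d + 1), σ t * ∑' q : Site (d + 1), H q * V t q v a b = ∑' q : Site (d + 1), H q * (σ t * V t q v a b) := by
    intro t
    rw [← tsum_mul_left]
    exact tsum_congr fun q => by ring
  refine ⟨hs'.prod.congr fun t => (e t).symm, ?_⟩
  calc ∑' t : Site (d + 1), σ t * ∑' q : Site (d + 1), H q * V t q v a b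
      = ∑' t : Site (d + 1), ∑' q : Site (d + 1), H q * (σ t * V t q v a b) := tsum_congr e
    _ = ∑' tq : Site (d + 1) × Site (d + 1), H tq.2 * (σ tq.1 * V tq.1 tq.2 v a b) := (hs'.tsum_prod).symm
    _ = ∑' qt : Site (d + 1) × Site (d + 1), H qt.1 * (σ qt.2 * V qt.2 qt.1 v a b) := by
        rw [← (Equiv.prodComm (Site (d + 1)) (Site (d + 1))).tsum_eq (fun tq : Site (d + 1) × Site (d + 1) => H tq.2 * (σ tq.1 * V tq.1 tq.2 v a b))]
        exact tsum_congr fun qt => by simp [Equiv.prodComm_apply]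
    _ = ∑' q : Site (d + 1), ∑' t : Site (d + 1), H q * (σ t * V t q v a b) := hs.tsum_prod
    _ = ∑' q : Site (d + 1), H q * ∑' t : Site (d + 1), σ t * V t q v a b := tsum_congr fun q => tsum_mul_left

/-! ## §2 The leg contraction when the multiplier response vanishes -/

omit [NeZero Lc] in
/-- [folklore] **IF THE MULTIPLIER RESPONSE OF `K` TO `ρ ê_β` VANISHES, THE `ρ`-WEIGHTED MULTIPLIER ROW OF `K ∘ V` IS MINUS THE FIELD RESPONSE CONTRACTED INTO `V`'S FIRST FIELD LEG**:
`Σ'_w ρ w·(K ∘ V)(N•w, v)(inr β, f) = −Σ_κ″ Σ'_q (Σ'_w ρ w·colH K N β w κ″ q)·V q v (inl κ″) f`. -/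
theorem tsum_leg_comp_eq_neg_fieldResponse {N : ℕ} (hN : 1 ≤ N) {K : MKer (d + 1) (Fib d)} {C δ : ℝ} (hK : Decays K C δ) (hδ : 0 < δ) (hKt : trK K = sgnK K)
    {V : MKer (d + 1) (Fib d)} {p : Site (d + 1)} {Cv δv : ℝ} (hV : BiLoc V p p Cv δv) (hδv : 0 < δv)
    {ρ : Site (d + 1) → ℝ} {B : ℝ} (hρ : ∀ w, |ρ w| ≤ B) (β : Fin (d + 1))
    (hM : ∀ (m : Fin (d + 1)) (q : Site (d + 1)), ∑' w : Site (d + 1), ρ w * K q ((N : ℤ) • w) (Sum.inr m) (Sum.inr β) = 0)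
    (v : Site (d + 1)) (f : Fib d) :
    ∑' w : Site (d + 1), ρ w * comp K V ((N : ℤ) • w) v (Sum.inr β) f =
      -(∑ κ'' : Fin (d + 1), ∑' q : Site (d + 1), (∑' w : Site (d + 1), ρ w * colH K N β w κ'' q) * V q v (Sum.inl κ'') f) := by
  rw [tsum_legWeight_mulRow_comp hN hK hδ hKt hV hδv hρ β v f]
  simp only [hM, zero_mul, tsum_zero, Finset.sum_const_zero, add_zero]

/-- [folklore] **THE FACE DATUM HAS ZERO MULTIPLIER RESPONSE UNDER `G_j`** (raw units): `Σ'_w 𝟙{w_β ≡ −1}·G_j q (Lc•w)(inr m)(inr β) = 0` — `FaceDatumMultiplierResponse` at units `(1,1)`. -/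
theorem tsum_face_mul_dressed_mm_raw_eq_zero (hr : r ∈ box (d + 1) Lc) (j : ℕ) (β m : Fin (d + 1)) (q : Site (d + 1)) :
    ∑' w : Site (d + 1), (if w β % (Lc : ℤ) = (Lc : ℤ) - 1 then (1 : ℝ) else 0) *
        coDressKBmAt (toSite r) Lc (KInvStep (d := d) Lc j) q ((Lc : ℤ) • w) (Sum.inr m) (Sum.inr β) = 0 := by
  have hLc : 1 ≤ Lc := Nat.one_le_iff_ne_zero.mpr (NeZero.ne Lc)
  have h := tsum_face_mul_dressed_mm_eq_zero (d := d) hLc hr 1 1 j β m q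
  rw [unitK_one] at h
  exact h

/-! ## §3 The descent identity -/

/-- [folklore] **DESCENT**: when the multiplier response of `G_j` to the leg datum `ρ ê_β` vanishes, the divergence of the level-`(j+1)` slot∕leg-weighted current at `y` is `−cH_j ×` the block sum
over `block(y)` of the second-leg lattice divergence of the level-`j` current `t^{(j)}(κ′,v) = Σ_κ″ Σ'_q H_ρ(κ″,q)·Σ_κ‴ Σ'_u σ′(κ‴,u)·S κ‴ u q v (inl κ″)(inl κ′)`. -/
theorem div_faceSlot_current_eq_neg_blockSum_descent (hr : r ∈ box (d + 1) Lc) (j : ℕ) (hS : LocStencil S Cs δs) (hδs : 0 < δs) (hpar : ∀ κ u, trK (S κ u) = -sgnK (S κ u))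
    {σ ρ : Site (d + 1) → ℝ} (hσ : ∀ t, |σ t| ≤ 1) (hρ : ∀ w, |ρ w| ≤ 1) (ν β : Fin (d + 1))
    (hM : ∀ (m : Fin (d + 1)) (q : Site (d + 1)), ∑' w : Site (d + 1), ρ w * coDressKBmAt (toSite r) Lc (KInvStep (d := d) Lc j) q ((Lc : ℤ) • w) (Sum.inr m) (Sum.inr β) = 0)
    (y : Site (d + 1)) :
    ∑ μ : Fin (d + 1), ((∑' w : Site (d + 1), ρ w * ∑' t : Site (d + 1), σ t * e3OfK Lc (coDressKBmAt (toSite r) Lc (KInvStep (d := d) Lc j)) S ν t y w (Sum.inl μ) (Sum.inl β))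
        - ∑' w : Site (d + 1), ρ w * ∑' t : Site (d + 1), σ t * e3OfK Lc (coDressKBmAt (toSite r) Lc (KInvStep (d := d) Lc j)) S ν t (y - unitVec μ) w (Sum.inl μ) (Sum.inl β)) =
      -((stepScale d Lc j * (Lc : ℝ) ^ (d + 1))⁻¹ *
        ∑ r' ∈ box (d + 1) Lc, ∑ κ' : Fin (d + 1),
          ((∑ κ'' : Fin (d + 1), ∑' q : Site (d + 1), (∑' w : Site (d + 1), ρ w * colH (coDressKBmAt (toSite r) Lc (KInvStep (d := d) Lc j)) Lc β w κ'' q) *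
              ∑ κ''' : Fin (d + 1), ∑' u : Site (d + 1), (∑' t : Site (d + 1), σ t * colH (coDressKBmAt (toSite r) Lc (KInvStep (d := d) Lc j)) Lc ν t κ''' u) *
                S κ''' u q ((Lc : ℤ) • y + toSite r') (Sum.inl κ'') (Sum.inl κ'))
          - (∑ κ'' : Fin (d + 1), ∑' q : Site (d + 1), (∑' w : Site (d + 1), ρ w * colH (coDressKBmAt (toSite r) Lc (KInvStep (d := d) Lc j)) Lc β w κ'' q) *
              ∑ κ''' : Fin (d + 1), ∑' u : Site (d + 1), (∑' t : Site (d + 1), σ t * colH (coDressKBmAt (toSite r) Lc (KInvStep (d := d) Lc j)) Lc ν t κ''' u) *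
                S κ''' u q ((Lc : ℤ) • y + toSite r' - unitVec κ') (Sum.inl κ'') (Sum.inl κ')))) := by
  classical
  have hLc : 1 ≤ Lc := Nat.one_le_iff_ne_zero.mpr (NeZero.ne Lc)
  -- constants: decay of `G_j`, bi-localisation of the vertex family, matched rates
  obtain ⟨δK, CK, hδK, hCK, hG⟩ := decays_coDressKBmAt_KInvStep (d := d) hr j
  have hCs : 0 ≤ Cs := (hS 0 0).nonneg (Sum.inl 0)
  obtain ⟨m, hm0, hmK, hmS⟩ : ∃ m : ℝ, 0 < m ∧ m ≤ δK ∧ m ≤ δs := ⟨min δK δs, lt_min hδK hδs, min_le_left _ _, min_le_right _ _⟩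
  have hG1 : Decays (coDressKBmAt (toSite r) Lc (KInvStep (d := d) Lc j)) CK m := decays_mono hG hCK le_rfl hmK
  have hS1 : LocStencil S Cs m := fun κ u => biLoc_mono (hS κ u) hCs hmS
  have hV := vertexFamily_vertexOfK (N := Lc) hG1 hCK hS1 hm0 le_rfl
  have hKt := trK_coDressKBmAt_KInvStep (d := d) hr j
  -- the bounded leg response
  have hH : ∀ κ'' q, |∑' w : Site (d + 1), ρ w * colH (coDressKBmAt (toSite r) Lc (KInvStep (d := d) Lc j)) Lc β w κ'' q| ≤
      1 * CK * (Real.exp (m * ((Lc : ℝ) * (d + 1))) * Zl (d + 1) m) := fun κ'' q => abs_legResponse_le hG1 hm0 hρ β κ'' q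
  -- per evaluation point `v`: the `w`-contraction, the `(q,t)` exchange, the vertex opened
  have key : ∀ (v : Site (d + 1)) (κ' : Fin (d + 1)),
      ∑' t : Site (d + 1), σ t * ∑' w : Site (d + 1), ρ w * comp (coDressKBmAt (toSite r) Lc (KInvStep (d := d) Lc j))
          (vertexOfK (coDressKBmAt (toSite r) Lc (KInvStep (d := d) Lc j)) Lc S ν t) ((Lc : ℤ) • w) v (Sum.inr β) (Sum.inl κ') =
      -(∑ κ'' : Fin (d + 1), ∑' q : Site (d + 1), (∑' w : Site (d + 1), ρ w * colH (coDressKBmAt (toSite r) Lc (KInvStep (d := d) Lc j)) Lc β w κ'' q) *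
          ∑ κ''' : Fin (d + 1), ∑' u : Site (d + 1), (∑' t : Site (d + 1), σ t * colH (coDressKBmAt (toSite r) Lc (KInvStep (d := d) Lc j)) Lc ν t κ''' u) *
            S κ''' u q v (Sum.inl κ'') (Sum.inl κ')) := by
    intro v κ'
    -- (C) the `w`-contraction, for each `t`
    have eC : ∀ t : Site (d + 1), ∑' w : Site (d + 1), ρ w * comp (coDressKBmAt (toSite r) Lc (KInvStep (d := d) Lc j))
        (vertexOfK (coDressKBmAt (toSite r) Lc (KInvStep (d := d) Lc j)) Lc S ν t) ((Lc : ℤ) • w) v (Sum.inr β) (Sum.inl κ') =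
        -(∑ κ'' : Fin (d + 1), ∑' q : Site (d + 1), (∑' w : Site (d + 1), ρ w * colH (coDressKBmAt (toSite r) Lc (KInvStep (d := d) Lc j)) Lc β w κ'' q) *
          vertexOfK (coDressKBmAt (toSite r) Lc (KInvStep (d := d) Lc j)) Lc S ν t q v (Sum.inl κ'') (Sum.inl κ')) := fun t =>
      tsum_leg_comp_eq_neg_fieldResponse hLc hG1 hm0 hKt (hV ν t) (by positivity) hρ β hM v (Sum.inl κ')
    rw [tsum_congr fun t => by rw [eC t]]
    simp only [mul_neg, tsum_neg, Finset.mul_sum]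
    congr 1
    -- the finite `κ''`-sum out of the `t`-sum
    have hF := fun κ'' : Fin (d + 1) => tsum_midleg_slot_comm (V := fun t => vertexOfK (coDressKBmAt (toSite r) Lc (KInvStep (d := d) Lc j)) Lc S ν t)
      (fun t => hV ν t) (by positivity) hσ (hH κ'') v (Sum.inl κ'') (Sum.inl κ')
    rw [Summable.tsum_finsetSum (fun κ'' _ => (hF κ'').1)]
    refine Finset.sum_congr rfl fun κ'' _ => ?_
    -- (D) the `(q,t)` exchange and the vertex opened by `SlotWeightedVertex`
    rw [(hF κ'').2]
    refine tsum_congr fun q => ?_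
    rw [tsum_slotWeight_vertexOfK hLc hG1 hm0 hS1 hm0 hσ ν q v (Sum.inl κ'') (Sum.inl κ'), Finset.mul_sum]
  rw [div_faceSlot_current_eq_blockSum hr j hS hδs hpar hσ hρ ν β y, ← mul_neg, ← Finset.sum_neg_distrib]
  congr 1
  refine Finset.sum_congr rfl fun r' _ => ?_
  rw [← Finset.sum_neg_distrib]
  refine Finset.sum_congr rfl fun κ' _ => ?_
  rw [key, key]
  ring

/-- [folklore] **COROLLARY — (D)_{j+1} FROM (D)_j POINTWISE ON THE BLOCK**: if the multiplier response of `G_j` to `ρ ê_β` vanishes and the level-`j` current `t^{(j)}` is second-leg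
divergence-free at every site `Lc•y + r′`, `r′ ∈ box Lc`, then the level-`(j+1)` current is divergence-free at `y`. -/
theorem div_faceSlot_current_eq_zero_of_descent (hr : r ∈ box (d + 1) Lc) (j : ℕ) (hS : LocStencil S Cs δs) (hδs : 0 < δs) (hpar : ∀ κ u, trK (S κ u) = -sgnK (S κ u))
    {σ ρ : Site (d + 1) → ℝ} (hσ : ∀ t, |σ t| ≤ 1) (hρ : ∀ w, |ρ w| ≤ 1) (ν β : Fin (d + 1))
    (hM : ∀ (m : Fin (d + 1)) (q : Site (d + 1)), ∑' w : Site (d + 1), ρ w * coDressKBmAt (toSite r) Lc (KInvStep (d := d) Lc j) q ((Lc : ℤ) • w) (Sum.inr m) (Sum.inr β) = 0)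
    (y : Site (d + 1))
    (hdiv : ∀ r' ∈ box (d + 1) Lc, ∑ κ' : Fin (d + 1),
      ((∑ κ'' : Fin (d + 1), ∑' q : Site (d + 1), (∑' w : Site (d + 1), ρ w * colH (coDressKBmAt (toSite r) Lc (KInvStep (d := d) Lc j)) Lc β w κ'' q) *
          ∑ κ''' : Fin (d + 1), ∑' u : Site (d + 1), (∑' t : Site (d + 1), σ t * colH (coDressKBmAt (toSite r) Lc (KInvStep (d := d) Lc j)) Lc ν t κ''' u) *
            S κ''' u q ((Lc : ℤ) • y + toSite r') (Sum.inl κ'') (Sum.inl κ'))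
        - (∑ κ'' : Fin (d + 1), ∑' q : Site (d + 1), (∑' w : Site (d + 1), ρ w * colH (coDressKBmAt (toSite r) Lc (KInvStep (d := d) Lc j)) Lc β w κ'' q) *
          ∑ κ''' : Fin (d + 1), ∑' u : Site (d + 1), (∑' t : Site (d + 1), σ t * colH (coDressKBmAt (toSite r) Lc (KInvStep (d := d) Lc j)) Lc ν t κ''' u) *
            S κ''' u q ((Lc : ℤ) • y + toSite r' - unitVec κ') (Sum.inl κ'') (Sum.inl κ'))) = 0) :
    ∑ μ : Fin (d + 1), ((∑' w : Site (d + 1), ρ w * ∑' t : Site (d + 1), σ t * e3OfK Lc (coDressKBmAt (toSite r) Lc (KInvStep (d := d) Lc j)) S ν t y w (Sum.inl μ) (Sum.inl β))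
        - ∑' w : Site (d + 1), ρ w * ∑' t : Site (d + 1), σ t * e3OfK Lc (coDressKBmAt (toSite r) Lc (KInvStep (d := d) Lc j)) S ν t (y - unitVec μ) w (Sum.inl μ) (Sum.inl β)) = 0 := by
  rw [div_faceSlot_current_eq_neg_blockSum_descent hr j hS hδs hpar hσ hρ ν β hM y, Finset.sum_eq_zero hdiv, mul_zero, neg_zero]

/-- [folklore] **THE FACE-LEG INSTANCE**: for the face datum `ρ = 𝟙{w_β ≡ −1 (Lc)}` the multiplier-response hypothesis holds, so the descent identity is unconditional. -/
theorem div_faceSlot_faceLeg_current_eq_zero_of_descent (hr : r ∈ box (d + 1) Lc) (j : ℕ) (hS : LocStencil S Cs δs) (hδs : 0 < δs) (hpar : ∀ κ u, trK (S κ u) = -sgnK (S κ u))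
    {σ : Site (d + 1) → ℝ} (hσ : ∀ t, |σ t| ≤ 1) (ν β : Fin (d + 1)) (y : Site (d + 1))
    (hdiv : ∀ r' ∈ box (d + 1) Lc, ∑ κ' : Fin (d + 1),
      ((∑ κ'' : Fin (d + 1), ∑' q : Site (d + 1), (∑' w : Site (d + 1), (if w β % (Lc : ℤ) = (Lc : ℤ) - 1 then (1 : ℝ) else 0) *
            colH (coDressKBmAt (toSite r) Lc (KInvStep (d := d) Lc j)) Lc β w κ'' q) *
          ∑ κ''' : Fin (d + 1), ∑' u : Site (d + 1), (∑' t : Site (d + 1), σ t * colH (coDressKBmAt (toSite r) Lc (KInvStep (d := d) Lc j)) Lc ν t κ''' u) *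
            S κ''' u q ((Lc : ℤ) • y + toSite r') (Sum.inl κ'') (Sum.inl κ'))
        - (∑ κ'' : Fin (d + 1), ∑' q : Site (d + 1), (∑' w : Site (d + 1), (if w β % (Lc : ℤ) = (Lc : ℤ) - 1 then (1 : ℝ) else 0) *
            colH (coDressKBmAt (toSite r) Lc (KInvStep (d := d) Lc j)) Lc β w κ'' q) *
          ∑ κ''' : Fin (d + 1), ∑' u : Site (d + 1), (∑' t : Site (d + 1), σ t * colH (coDressKBmAt (toSite r) Lc (KInvStep (d := d) Lc j)) Lc ν t κ''' u) *
            S κ''' u q ((Lc : ℤ) • y + toSite r' - unitVec κ') (Sum.inl κ'') (Sum.inl κ'))) = 0) :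
    ∑ μ : Fin (d + 1), ((∑' w : Site (d + 1), (if w β % (Lc : ℤ) = (Lc : ℤ) - 1 then (1 : ℝ) else 0) *
          ∑' t : Site (d + 1), σ t * e3OfK Lc (coDressKBmAt (toSite r) Lc (KInvStep (d := d) Lc j)) S ν t y w (Sum.inl μ) (Sum.inl β))
        - ∑' w : Site (d + 1), (if w β % (Lc : ℤ) = (Lc : ℤ) - 1 then (1 : ℝ) else 0) *
          ∑' t : Site (d + 1), σ t * e3OfK Lc (coDressKBmAt (toSite r) Lc (KInvStep (d := d) Lc j)) S ν t (y - unitVec μ) w (Sum.inl μ) (Sum.inl β)) = 0 :=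
  div_faceSlot_current_eq_zero_of_descent hr j hS hδs hpar hσ (fun w => by split_ifs <;> simp) ν β
    (fun m q => tsum_face_mul_dressed_mm_raw_eq_zero hr j β m q) y hdiv

end Summit.QuantumFields.BalabanUV.Beta.GAN24.ExitFaceCurrentDescent
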